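import Mathlib.Analysis.SpecialFunctions.Log.Basic
import Mathlib.Topology.Algebra.InfiniteSum.Real
import Mathlib.Topology.Algebra.Order.LiminfLimsup
import Mathlib.Analysis.SpecificLimits.Basic
import HarnessLib

/-!
# The perturbative flow of the coupling constant: `ḡ_{j+1} = ḡ_j - β_j ḡ_j²`
# (Bauerschmidt–Brydges–Slade 2015, §6.1 and §8.3; [BBS-rg-flow], Lemma 2.1)

Support file for the renormalisation-group half of
`Literature.Barriers.CriticalPhenomena.WeaklySAWFourDimLogCorrections` (= BBS 2015, Theorem 1.1,
`CTWSAW.BBS2015_thm11`), which the tree reduces to Theorem 4.1 (`CTWSAW.BBS2015_thm41`,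
`WeaklySAWFourDimLogCorrectionsReduction.lean`) and Lemma A.1. Theorem 4.1 is the output of the
rigorous renormalisation group of §5–§8 of the source and its companion papers. Its ELEMENTARY
layer is the "quadratic flow" of the coupling constants (§6.1, the proposition on the global
flow of `φ̄`, a special case of [BBS-rg-flow, Proposition 1.2]), whose first coordinate is the
recursion

  `ḡ_{j+1} = ḡ_j - β_j ḡ_j²`, `ḡ_0 = g_0 > 0`, with `β_j ≥ 0` bounded

(`β_j = 8Σ_x(w_{j+1,x}² - w_{j,x}²) > 0`, the bubble increments of the finite-range decomposition,
§6.1), and the mechanism by which the free bubble diagram enters the critical behaviour: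
`Σ_j β_j = 𝖡_{m²}` (§8.3, first lemma) and `ǧ_∞ ∼ 1/𝖡_{m²}` (§8.3, second lemma, proved there
for the perturbed recursion `ǧ_{j+1} = ǧ_j - β_jǧ_j² + r_j`, `r_j = O(χ_jǧ_j³)`, from
`ǧ_k⁻¹ = g₀⁻¹ + Σ_{j<k} β_j + O(log ǧ_k)`, the display in the proof of that lemma).

This file proves, for the unperturbed recursion (`r_j = 0`, i.e. the sequence `ḡ` of the source)
and with explicit constants in place of the printed `O(·)` (smallness fixed as `B g₀ ≤ 1/4`,
`B = sup_j β_j`):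
* [BBS-rg-flow, Lemma 2.1(i)] for `β ≥ 0`: `0 < ḡ_{j+1} ≤ ḡ_j ≤ g₀` and
  `ḡ_j/ḡ_{j+1} = (1 - β_jḡ_j)⁻¹ ∈ [1, 4/3]` (`gbar_pos`, `gbar_succ_le`, `gbar_antitone`,
  `gbar_div_gbar_succ`);
* the reciprocal identity `ḡ_k⁻¹ = g₀⁻¹ + Σ_{j<k} β_j/(1 - β_jḡ_j)` (`inv_gbar_eq`) and the
  two-sided form of that display with `r = 0`:
  `g₀⁻¹ + Σ_{j<k}β_j ≤ ḡ_k⁻¹ ≤ g₀⁻¹ + Σ_{j<k}β_j + (4B/3) log(g₀/ḡ_k)` (`inv_gbar_ge`,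
  `inv_gbar_le`), via `Σ_{j<k} β_jḡ_j ≤ log(g₀/ḡ_k)` (`sum_beta_mul_gbar_le_log`); hence
  `g₀/(1 + (4/3)g₀S_k) ≤ ḡ_k ≤ g₀/(1 + g₀S_k)`, `S_k = Σ_{j<k}β_j` ([BBS-rg-flow, Example 1.1(i)
  and Lemma 2.1(ii)(b) with `n = 1`, `χ_j = 1`]; `gbar_le_of_sum`, `le_gbar_of_sum`);
* for summable `β` (`S = Σ_jβ_j`, which is `𝖡_{m²}` in the source): the limit `ḡ_∞ = lim ḡ_j > 0`
  exists (`tendsto_gbar_gbarLim`) and `g₀⁻¹ + S ≤ ḡ_∞⁻¹ ≤ g₀⁻¹ + S + (4B/3) log(1 + (3/2)g₀S)`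
  (`inv_gbarLim_ge`, `inv_gbarLim_le`) — the `r = 0` case of "`ǧ_∞⁻¹ + O(|log ǧ_∞|) = g₀⁻¹ + 𝖡_{m²}`";
* the asymptotic statement of the second lemma of §8.3 in this setting: along any filter on which
  `S → ∞` and `g₀ → ĝ₀ > 0`, `ḡ_∞ · S → 1` (`tendsto_gbarLim_mul_sum`), i.e. `ḡ_∞ ∼ 1/𝖡_{m²}` as
  `(m², g₀) → (0, ĝ₀)` once `Σβ_j = 𝖡_{m²} → ∞` ((1.8), `BBS2015_eq18_holds`).

Not here: the remainder `r_j` (which needs the estimates of the renormalisation-group step, §6.4),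
the `χ_j`-weighted bounds `Σ_{l=j}^k χ_lḡ_lⁿ ≤ …` ([BBS-rg-flow, Lemma 2.1(ii)(a)]) and the `z̄, μ̄`
equations of the quadratic flow ([BBS-rg-flow, Lemma 2.2]).

## References
* R. Bauerschmidt, D. C. Brydges, G. Slade, *Logarithmic correction for the susceptibility of the
  4-dimensional weakly self-avoiding walk: a renormalisation group analysis*, CMP 337 (2015),
  §6.1 and §8.3. [BauerschmidtBrydgesSlade2015LogCorr]
* R. Bauerschmidt, D. C. Brydges, G. Slade, *Structural stability of a dynamical system near a
  non-hyperbolic fixed point*, Ann. Henri Poincaré 16 (2015), Example 1.1, Lemma 2.1.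
  [BauerschmidtBrydgesSlade2015Flow]
-/

noncomputable section

open Filter Topology Finset
open scoped BigOperators

namespace Literature.Barriers.CriticalPhenomena

namespace CTWSAW

/-! ### The recursion and the standing hypotheses -/

/-- The perturbative flow `ḡ = ḡ(β, g₀)` of the coupling constant: `ḡ₀ = g₀`,
`ḡ_{j+1} = ḡ_j - β_j ḡ_j²`. [cite: BauerschmidtBrydgesSlade2015Flow, §1.3 and §2.1 (the recursion for ḡ)]
[cite: BauerschmidtBrydgesSlade2015LogCorr, §6.1 (the ḡ-equation of the quadratic flow φ̄)] -/
def gbar (β : ℕ → ℝ) (g₀ : ℝ) : ℕ → ℝ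
  | 0 => g₀
  | j + 1 => gbar β g₀ j - β j * gbar β g₀ j ^ 2

/-- `ḡ₀ = g₀`. [cite: BauerschmidtBrydgesSlade2015Flow, §2.1 (the recursion for ḡ, ḡ₀ = g₀)] -/
@[simp] theorem gbar_zero (β : ℕ → ℝ) (g₀ : ℝ) : gbar β g₀ 0 = g₀ := rfl

/-- `ḡ_{j+1} = ḡ_j - β_jḡ_j²`. [cite: BauerschmidtBrydgesSlade2015Flow, §2.1 (the recursion for ḡ)] -/
theorem gbar_succ (β : ℕ → ℝ) (g₀ : ℝ) (j : ℕ) :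
    gbar β g₀ (j + 1) = gbar β g₀ j - β j * gbar β g₀ j ^ 2 := rfl

/-- `ḡ_{j+1} = ḡ_j(1 - β_jḡ_j)`. [cite: BauerschmidtBrydgesSlade2015Flow, Lemma 2.1 (proof of (i), first display)] -/
theorem gbar_succ' (β : ℕ → ℝ) (g₀ : ℝ) (j : ℕ) :
    gbar β g₀ (j + 1) = gbar β g₀ j * (1 - β j * gbar β g₀ j) := by
  rw [gbar_succ]; ring

/-- The limit `ḡ_∞ = lim_j ḡ_j`, realised as `inf_j ḡ_j` (the sequence is non-increasing under
`GbarHyp`, `tendsto_gbar_gbarLim`). [cite: BauerschmidtBrydgesSlade2015LogCorr, §8.3 (second lemma: ǧ_∞ = lim ǧ_j)] -/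
def gbarLim (β : ℕ → ℝ) (g₀ : ℝ) : ℝ :=
  ⨅ j, gbar β g₀ j

/-- Standing hypotheses for the flow of `ḡ`: `0 ≤ β_j ≤ B` for all `j` (in the source `β_j > 0`,
§6.1, and `β_max = sup_j|β_j| < ∞`, Assumption (A1)), `g₀ > 0`, and the smallness "`ḡ₀ > 0`
sufficiently small depending on `‖β‖_∞`" fixed as `B g₀ ≤ 1/4`.
[cite: BauerschmidtBrydgesSlade2015Flow, Assumption (A1) and Lemma 2.1]
[cite: BauerschmidtBrydgesSlade2015LogCorr, §6.1 (β_j > 0, Assumption (A1))] -/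
structure GbarHyp (β : ℕ → ℝ) (B g₀ : ℝ) : Prop where
  /-- `β_j ≥ 0`. -/
  beta_nonneg : ∀ j, 0 ≤ β j
  /-- `β_j ≤ B`. -/
  beta_le : ∀ j, β j ≤ B
  /-- `g₀ > 0`. -/
  pos : 0 < g₀
  /-- smallness of `g₀` relative to `B = sup β`. -/
  small : B * g₀ ≤ 1 / 4

namespace GbarHyp

variable {β : ℕ → ℝ} {B g₀ : ℝ} (h : GbarHyp β B g₀)
include h

/-- `B ≥ 0`. [folklore] -/
theorem B_nonneg : 0 ≤ B := (h.beta_nonneg 0).trans (h.beta_le 0)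

/-! ### [BBS-rg-flow, Lemma 2.1(i)]: positivity and monotonicity -/

/-- `0 < ḡ_j ≤ g₀` for all `j`. [cite: BauerschmidtBrydgesSlade2015Flow, Lemma 2.1(i)] -/
theorem gbar_pos_and_le (j : ℕ) : 0 < gbar β g₀ j ∧ gbar β g₀ j ≤ g₀ := by
  induction j with
  | zero => exact ⟨by simpa using h.pos, by simp⟩
  | succ j ih =>
    obtain ⟨hpos, hle⟩ := ih
    have ht0 : 0 ≤ β j * gbar β g₀ j := mul_nonneg (h.beta_nonneg j) hpos.le
    have ht1 : β j * gbar β g₀ j ≤ 1 / 4 :=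
      (mul_le_mul (h.beta_le j) hle hpos.le h.B_nonneg).trans h.small
    rw [gbar_succ']
    refine ⟨mul_pos hpos (by linarith), ?_⟩
    calc gbar β g₀ j * (1 - β j * gbar β g₀ j) ≤ gbar β g₀ j * 1 :=
          mul_le_mul_of_nonneg_left (by linarith) hpos.le
      _ ≤ g₀ := by rw [mul_one]; exact hle

/-- `ḡ_j > 0`. [cite: BauerschmidtBrydgesSlade2015Flow, Lemma 2.1(i)] -/
theorem gbar_pos (j : ℕ) : 0 < gbar β g₀ j := (h.gbar_pos_and_le j).1

/-- `ḡ_j ≤ g₀`. [cite: BauerschmidtBrydgesSlade2015Flow, Lemma 2.1(i) (ḡ_j = O(inf_{k≤j} ḡ_k))] -/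
theorem gbar_le_init (j : ℕ) : gbar β g₀ j ≤ g₀ := (h.gbar_pos_and_le j).2

/-- `0 ≤ β_jḡ_j`. [folklore] -/
theorem beta_mul_gbar_nonneg (j : ℕ) : 0 ≤ β j * gbar β g₀ j :=
  mul_nonneg (h.beta_nonneg j) (h.gbar_pos j).le

/-- `β_jḡ_j ≤ Bḡ_j`. [folklore] -/
theorem beta_mul_gbar_le' (j : ℕ) : β j * gbar β g₀ j ≤ B * gbar β g₀ j :=
  mul_le_mul_of_nonneg_right (h.beta_le j) (h.gbar_pos j).le

/-- `β_jḡ_j ≤ Bg₀ ≤ 1/4`. [cite: BauerschmidtBrydgesSlade2015Flow, Lemma 2.1 (proof of (i))] -/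
theorem beta_mul_gbar_le (j : ℕ) : β j * gbar β g₀ j ≤ 1 / 4 :=
  (mul_le_mul (h.beta_le j) (h.gbar_le_init j) (h.gbar_pos j).le h.B_nonneg).trans h.small

/-- `3/4 ≤ 1 - β_jḡ_j`. [folklore] -/
theorem one_sub_ge (j : ℕ) : 3 / 4 ≤ 1 - β j * gbar β g₀ j := by
  linarith [h.beta_mul_gbar_le j]

/-- `ḡ_{j+1} ≤ ḡ_j` (`β_j ≥ 0`). [cite: BauerschmidtBrydgesSlade2015Flow, Lemma 2.1(i)] -/
theorem gbar_succ_le (j : ℕ) : gbar β g₀ (j + 1) ≤ gbar β g₀ j := by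
  rw [gbar_succ]
  nlinarith [h.beta_nonneg j, sq_nonneg (gbar β g₀ j)]

/-- `ḡ` is non-increasing. [cite: BauerschmidtBrydgesSlade2015Flow, Lemma 2.1(i)] -/
theorem gbar_antitone : Antitone (gbar β g₀) :=
  antitone_nat_of_succ_le h.gbar_succ_le

/-- `ḡ_j/ḡ_{j+1} = (1 - β_jḡ_j)⁻¹` ("`ḡ_jḡ_{j+1}⁻¹ = 1 + O(ḡ₀)`").
[cite: BauerschmidtBrydgesSlade2015Flow, Lemma 2.1(i) (ḡ_jḡ_{j+1}⁻¹ = 1 + O(χ_jḡ_j) = 1 + O(ḡ₀))] -/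
theorem gbar_div_gbar_succ (j : ℕ) :
    gbar β g₀ j / gbar β g₀ (j + 1) = (1 - β j * gbar β g₀ j)⁻¹ := by
  have hg := (h.gbar_pos j).ne'
  rw [gbar_succ', div_mul_eq_div_div, div_self hg, one_div]

/-- `1 ≤ ḡ_j/ḡ_{j+1} ≤ 4/3`. [cite: BauerschmidtBrydgesSlade2015Flow, Lemma 2.1(i) (ḡ_jḡ_{j+1}⁻¹ = 1 + O(χ_jḡ_j) = 1 + O(ḡ₀))] -/
theorem gbar_div_gbar_succ_mem (j : ℕ) :
    gbar β g₀ j / gbar β g₀ (j + 1) ∈ Set.Icc (1 : ℝ) (4 / 3) := by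
  rw [h.gbar_div_gbar_succ j]
  have h34 := h.one_sub_ge j
  have ht := h.beta_mul_gbar_nonneg j
  constructor
  · rw [le_inv_comm₀ one_pos (by linarith), inv_one]; linarith
  · rw [inv_le_comm₀ (by linarith) (by norm_num)]; linarith

/-! ### The reciprocal identity and `ḡ_k⁻¹ = g₀⁻¹ + Σ_{j<k}β_j + O(log)` (`r = 0`) -/

/-- One step of the reciprocal recursion: `ḡ_{j+1}⁻¹ = ḡ_j⁻¹ + β_j/(1 - β_jḡ_j)`.
[cite: BauerschmidtBrydgesSlade2015LogCorr, §8.3 (proof of the second lemma, ψ(t) = t⁻²)] -/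
theorem inv_gbar_succ (j : ℕ) :
    (gbar β g₀ (j + 1))⁻¹ = (gbar β g₀ j)⁻¹ + β j / (1 - β j * gbar β g₀ j) := by
  have hg := (h.gbar_pos j).ne'
  have h1 : (1 - β j * gbar β g₀ j) ≠ 0 := by linarith [h.one_sub_ge j]
  have h1' : (1 - gbar β g₀ j * β j) ≠ 0 := by rwa [mul_comm]
  rw [gbar_succ']
  field_simp
  ring

/-- **The reciprocal identity** `ḡ_k⁻¹ = g₀⁻¹ + Σ_{j<k} β_j/(1 - β_jḡ_j)`.
[cite: BauerschmidtBrydgesSlade2015LogCorr, §8.3, eq. before the second lemma's conclusion (ǧ_k⁻¹ = g₀⁻¹ + Σβ_j + O(log ǧ_k))] -/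
theorem inv_gbar_eq (k : ℕ) :
    (gbar β g₀ k)⁻¹ = g₀⁻¹ + ∑ j ∈ range k, β j / (1 - β j * gbar β g₀ j) := by
  induction k with
  | zero => simp
  | succ k ih => rw [h.inv_gbar_succ, ih, sum_range_succ]; ring

/-- `β_j ≤ β_j/(1 - β_jḡ_j)`. [folklore] -/
theorem beta_le_div (j : ℕ) : β j ≤ β j / (1 - β j * gbar β g₀ j) := by
  have h34 := h.one_sub_ge j
  rw [le_div_iff₀ (by linarith)]
  nlinarith [h.beta_nonneg j, h.beta_mul_gbar_nonneg j]

/-- `β_j/(1 - β_jḡ_j) = β_j + β_j²ḡ_j/(1 - β_jḡ_j)`. [folklore] -/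
theorem beta_div_eq (j : ℕ) :
    β j / (1 - β j * gbar β g₀ j) =
      β j + β j ^ 2 * gbar β g₀ j / (1 - β j * gbar β g₀ j) := by
  have h1 : (1 - β j * gbar β g₀ j) ≠ 0 := by linarith [h.one_sub_ge j]
  field_simp
  ring

/-- The lower half of `ǧ_k⁻¹ = g₀⁻¹ + Σ_{j<k}β_j + O(log ǧ_k)` with `r = 0` (exact, no error term):
`g₀⁻¹ + Σ_{j<k} β_j ≤ ḡ_k⁻¹`.
[cite: BauerschmidtBrydgesSlade2015LogCorr, §8.3 (ǧ_k⁻¹ = g₀⁻¹ + Σ_{j<k}β_j + O(log ǧ_k), r = 0)] -/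
theorem inv_gbar_ge (k : ℕ) : g₀⁻¹ + ∑ j ∈ range k, β j ≤ (gbar β g₀ k)⁻¹ := by
  rw [h.inv_gbar_eq k]
  exact add_le_add le_rfl (sum_le_sum fun j _ => h.beta_le_div j)

/-- `log(ḡ_j/ḡ_{j+1}) ≥ β_jḡ_j` (from `log(1 - t) ≤ -t`). [cite: BauerschmidtBrydgesSlade2015Flow, Lemma 2.1 (proof of (i): 1 - t ≤ e^{-t})] -/
theorem beta_mul_gbar_le_log (j : ℕ) :
    β j * gbar β g₀ j ≤ Real.log (gbar β g₀ j) - Real.log (gbar β g₀ (j + 1)) := by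
  have h34 := h.one_sub_ge j
  rw [gbar_succ', Real.log_mul (h.gbar_pos j).ne' (by linarith)]
  have := Real.log_le_sub_one_of_pos (show 0 < 1 - β j * gbar β g₀ j by linarith)
  linarith

/-- `Σ_{j<k} β_jḡ_j ≤ log(g₀/ḡ_k)` (telescoping `log(ḡ_j/ḡ_{j+1}) ≥ β_jḡ_j`).
[cite: BauerschmidtBrydgesSlade2015Flow, Lemma 2.1(ii) (proof of (ii-a): the sum–integral comparison, with ψ(t) = t⁻¹)] -/
theorem sum_beta_mul_gbar_le_log (k : ℕ) :
    ∑ j ∈ range k, β j * gbar β g₀ j ≤ Real.log (g₀ / gbar β g₀ k) := by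
  rw [Real.log_div h.pos.ne' (h.gbar_pos k).ne']
  calc ∑ j ∈ range k, β j * gbar β g₀ j
      ≤ ∑ j ∈ range k, (Real.log (gbar β g₀ j) - Real.log (gbar β g₀ (j + 1))) :=
        sum_le_sum fun j _ => h.beta_mul_gbar_le_log j
    _ = Real.log g₀ - Real.log (gbar β g₀ k) := by
        rw [sum_range_sub' (fun j => Real.log (gbar β g₀ j)), gbar_zero]

/-- The error term with `r = 0`: `β_j²ḡ_j/(1 - β_jḡ_j) ≤ (4B/3)·β_jḡ_j`. [folklore] -/
theorem err_term_le (j : ℕ) :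
    β j ^ 2 * gbar β g₀ j / (1 - β j * gbar β g₀ j) ≤ 4 / 3 * B * (β j * gbar β g₀ j) := by
  have h34 := h.one_sub_ge j
  rw [div_le_iff₀ (by linarith)]
  have hb := h.beta_nonneg j
  have hbB := h.beta_le j
  have ht := h.beta_mul_gbar_nonneg j
  have ht4 := h.beta_mul_gbar_le j
  -- β²ḡ = β·(βḡ) ≤ B·(βḡ); and (4/3)B(βḡ)(1 - βḡ) ≥ (4/3)B(βḡ)(3/4) = B(βḡ)
  have h1 : β j ^ 2 * gbar β g₀ j = β j * (β j * gbar β g₀ j) := by ring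
  rw [h1]
  have hB := h.B_nonneg
  nlinarith [mul_le_mul_of_nonneg_right hbB ht, mul_nonneg hB ht]

/-- **`ǧ_k⁻¹ = g₀⁻¹ + Σ_{j<k}β_j + O(log ǧ_k)` with `r = 0`, upper half**:
`ḡ_k⁻¹ ≤ g₀⁻¹ + Σ_{j<k} β_j + (4B/3) log(g₀/ḡ_k)`.
[cite: BauerschmidtBrydgesSlade2015LogCorr, §8.3 (ǧ_k⁻¹ = g₀⁻¹ + Σ_{j<k}β_j + O(log ǧ_k))] -/
theorem inv_gbar_le (k : ℕ) :
    (gbar β g₀ k)⁻¹ ≤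
      g₀⁻¹ + ∑ j ∈ range k, β j + 4 / 3 * B * Real.log (g₀ / gbar β g₀ k) := by
  rw [h.inv_gbar_eq k, add_assoc]
  refine add_le_add le_rfl ?_
  calc ∑ j ∈ range k, β j / (1 - β j * gbar β g₀ j)
      = ∑ j ∈ range k, (β j + β j ^ 2 * gbar β g₀ j / (1 - β j * gbar β g₀ j)) :=
        sum_congr rfl fun j _ => h.beta_div_eq j
    _ ≤ ∑ j ∈ range k, (β j + 4 / 3 * B * (β j * gbar β g₀ j)) :=
        sum_le_sum fun j _ => add_le_add le_rfl (h.err_term_le j)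
    _ = ∑ j ∈ range k, β j + 4 / 3 * B * ∑ j ∈ range k, β j * gbar β g₀ j := by
        rw [sum_add_distrib, mul_sum]
    _ ≤ ∑ j ∈ range k, β j + 4 / 3 * B * Real.log (g₀ / gbar β g₀ k) :=
        add_le_add le_rfl (mul_le_mul_of_nonneg_left (h.sum_beta_mul_gbar_le_log k)
          (by linarith [h.B_nonneg]))

/-- A cruder upper bound without logarithm: `ḡ_k⁻¹ ≤ g₀⁻¹ + (4/3)Σ_{j<k} β_j`
(each `β_j/(1 - β_jḡ_j) ≤ (4/3)β_j`). [cite: BauerschmidtBrydgesSlade2015Flow, Example 1.1(i)] -/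
theorem inv_gbar_le' (k : ℕ) : (gbar β g₀ k)⁻¹ ≤ g₀⁻¹ + 4 / 3 * ∑ j ∈ range k, β j := by
  rw [h.inv_gbar_eq k, mul_sum]
  refine add_le_add le_rfl (sum_le_sum fun j _ => ?_)
  have h34 := h.one_sub_ge j
  rw [div_le_iff₀ (by linarith)]
  nlinarith [h.beta_nonneg j, h.beta_mul_gbar_le j]

/-- **`ḡ_k ≤ g₀/(1 + g₀S_k)`**, `S_k = Σ_{j<k}β_j`. [cite: BauerschmidtBrydgesSlade2015Flow, Example 1.1(i) and Lemma 2.1(ii)(b) (n = 1)] -/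
theorem gbar_le_of_sum (k : ℕ) : gbar β g₀ k ≤ g₀ / (1 + g₀ * ∑ j ∈ range k, β j) := by
  have hS : 0 ≤ ∑ j ∈ range k, β j := sum_nonneg fun j _ => h.beta_nonneg j
  have hpos' : 0 < g₀⁻¹ + ∑ j ∈ range k, β j := add_pos_of_pos_of_nonneg (inv_pos.2 h.pos) hS
  calc gbar β g₀ k = ((gbar β g₀ k)⁻¹)⁻¹ := (inv_inv _).symm
    _ ≤ (g₀⁻¹ + ∑ j ∈ range k, β j)⁻¹ := inv_anti₀ hpos' (h.inv_gbar_ge k)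
    _ = g₀ / (1 + g₀ * ∑ j ∈ range k, β j) := by
        have := h.pos.ne'
        field_simp

/-- **`g₀/(1 + (4/3)g₀S_k) ≤ ḡ_k`**, `S_k = Σ_{j<k}β_j`. [cite: BauerschmidtBrydgesSlade2015Flow, Example 1.1(i) and Lemma 2.1(ii)(b) (n = 1)] -/
theorem le_gbar_of_sum (k : ℕ) : g₀ / (1 + 4 / 3 * g₀ * ∑ j ∈ range k, β j) ≤ gbar β g₀ k := by
  have hg := h.gbar_pos k
  calc g₀ / (1 + 4 / 3 * g₀ * ∑ j ∈ range k, β j) = (g₀⁻¹ + 4 / 3 * ∑ j ∈ range k, β j)⁻¹ := by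
        have := h.pos.ne'
        field_simp
    _ ≤ ((gbar β g₀ k)⁻¹)⁻¹ := inv_anti₀ (inv_pos.2 hg) (h.inv_gbar_le' k)
    _ = gbar β g₀ k := inv_inv _

/-! ### The limit `ḡ_∞` for summable `β` (`Σ_jβ_j = 𝖡_{m²}` in the source) -/

/-- `{ḡ_j}` is bounded below (by `0`). [folklore] -/
theorem bddBelow_range_gbar : BddBelow (Set.range (gbar β g₀)) :=
  ⟨0, by rintro _ ⟨j, rfl⟩; exact (h.gbar_pos j).le⟩

/-- `ḡ_∞ ≤ ḡ_j`. [cite: BauerschmidtBrydgesSlade2015LogCorr, §8.3 (second lemma: ǧ_∞ = lim ǧ_j)] -/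
theorem gbarLim_le (j : ℕ) : gbarLim β g₀ ≤ gbar β g₀ j :=
  ciInf_le h.bddBelow_range_gbar j

/-- **`ḡ_j → ḡ_∞`** (monotone convergence). [cite: BauerschmidtBrydgesSlade2015LogCorr, §8.3 (second lemma: the limit ǧ_∞ = lim ǧ_j exists)] -/
theorem tendsto_gbar_gbarLim : Tendsto (gbar β g₀) atTop (𝓝 (gbarLim β g₀)) :=
  tendsto_atTop_ciInf h.gbar_antitone h.bddBelow_range_gbar

/-- Partial sums are bounded by the sum (`β ≥ 0` summable). [folklore] -/
theorem sum_range_le_tsum (hs : Summable β) (k : ℕ) : ∑ j ∈ range k, β j ≤ ∑' j, β j :=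
  hs.sum_le_tsum (range k) fun j _ => h.beta_nonneg j

/-- `0 ≤ Σ_jβ_j`. [folklore] -/
theorem tsum_beta_nonneg : 0 ≤ ∑' j, β j := _root_.tsum_nonneg h.beta_nonneg

/-- For summable `β`: `g₀/(1 + (4/3)g₀Σ_jβ_j) ≤ ḡ_∞`; in particular `ḡ_∞ > 0`.
[cite: BauerschmidtBrydgesSlade2015LogCorr, §8.3 (second lemma, r = 0)] -/
theorem le_gbarLim (hs : Summable β) : g₀ / (1 + 4 / 3 * g₀ * ∑' j, β j) ≤ gbarLim β g₀ := by
  refine le_ciInf fun k => le_trans ?_ (h.le_gbar_of_sum k)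
  have hSk : 0 ≤ ∑ j ∈ range k, β j := sum_nonneg fun j _ => h.beta_nonneg j
  have h1 : 0 < 1 + 4 / 3 * g₀ * ∑ j ∈ range k, β j := by nlinarith [h.pos]
  refine div_le_div_of_nonneg_left h.pos.le h1 ?_
  nlinarith [h.sum_range_le_tsum hs k, h.pos]

/-- `ḡ_∞ > 0` for summable `β`. [cite: BauerschmidtBrydgesSlade2015LogCorr, §8.3 (second lemma, r = 0)] -/
theorem gbarLim_pos (hs : Summable β) : 0 < gbarLim β g₀ := by
  refine lt_of_lt_of_le (div_pos h.pos ?_) (h.le_gbarLim hs)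
  nlinarith [h.tsum_beta_nonneg, h.pos]

/-- **`ǧ_∞⁻¹ + O(|log ǧ_∞|) = g₀⁻¹ + 𝖡_{m²}` with `r = 0`, lower half (exact)**: `g₀⁻¹ + Σ_jβ_j ≤ ḡ_∞⁻¹`.
[cite: BauerschmidtBrydgesSlade2015LogCorr, §8.3 (ǧ_∞⁻¹ + O(|log ǧ_∞|) = g₀⁻¹ + 𝖡_{m²})] -/
theorem inv_gbarLim_ge (hs : Summable β) : g₀⁻¹ + ∑' j, β j ≤ (gbarLim β g₀)⁻¹ := by
  have hlim : Tendsto (fun k => g₀⁻¹ + ∑ j ∈ range k, β j) atTop (𝓝 (g₀⁻¹ + ∑' j, β j)) :=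
    tendsto_const_nhds.add hs.hasSum.tendsto_sum_nat
  refine le_of_tendsto' hlim fun k => (h.inv_gbar_ge k).trans ?_
  exact inv_anti₀ (h.gbarLim_pos hs) (h.gbarLim_le k)

/-- `ǧ_∞⁻¹ + O(|log ǧ_∞|) = g₀⁻¹ + 𝖡_{m²}` with `r = 0`, upper half in implicit form:
`ḡ_∞⁻¹ ≤ g₀⁻¹ + Σ_jβ_j + (4B/3) log(g₀/ḡ_∞)`.
[cite: BauerschmidtBrydgesSlade2015LogCorr, §8.3 (ǧ_∞⁻¹ + O(|log ǧ_∞|) = g₀⁻¹ + 𝖡_{m²})] -/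
theorem inv_gbarLim_le_log (hs : Summable β) :
    (gbarLim β g₀)⁻¹ ≤ g₀⁻¹ + ∑' j, β j + 4 / 3 * B * Real.log (g₀ / gbarLim β g₀) := by
  have hL := h.gbarLim_pos hs
  have hlim : Tendsto (fun k => (gbar β g₀ k)⁻¹) atTop (𝓝 (gbarLim β g₀)⁻¹) :=
    h.tendsto_gbar_gbarLim.inv₀ hL.ne'
  refine le_of_tendsto' hlim fun k => (h.inv_gbar_le k).trans ?_
  have hB : 0 ≤ 4 / 3 * B := by linarith [h.B_nonneg]
  refine add_le_add (add_le_add le_rfl (h.sum_range_le_tsum hs k)) (mul_le_mul_of_nonneg_left ?_ hB)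
  refine Real.log_le_log (div_pos h.pos (h.gbar_pos k)) ?_
  exact div_le_div_of_nonneg_left h.pos.le hL (h.gbarLim_le k)

/-- The ratio `g₀/ḡ_∞` is at least `1 + g₀Σ_jβ_j (≥ 1)`. [cite: BauerschmidtBrydgesSlade2015LogCorr, §8.3 (second lemma, r = 0)] -/
theorem one_add_le_div_gbarLim (hs : Summable β) : 1 + g₀ * ∑' j, β j ≤ g₀ / gbarLim β g₀ := by
  have := mul_le_mul_of_nonneg_left (h.inv_gbarLim_ge hs) h.pos.le
  rw [mul_add, mul_inv_cancel₀ h.pos.ne'] at this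
  simpa [div_eq_mul_inv] using this

/-- The ratio `g₀/ḡ_∞` is at most `1 + (3/2)g₀Σ_jβ_j` (resolving the implicit logarithmic bound with
`log y ≤ y - 1` and `(4/3)Bg₀ ≤ 1/3`). [cite: BauerschmidtBrydgesSlade2015LogCorr, §8.3 (second lemma, r = 0)] -/
theorem div_gbarLim_le (hs : Summable β) :
    g₀ / gbarLim β g₀ ≤ 1 + 3 / 2 * (g₀ * ∑' j, β j) := by
  set y := g₀ / gbarLim β g₀ with hy
  have hy1 : 1 ≤ y :=
    le_trans (by nlinarith [h.tsum_beta_nonneg, h.pos]) (h.one_add_le_div_gbarLim hs)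
  have hlog : Real.log y ≤ y - 1 := Real.log_le_sub_one_of_pos (by linarith)
  have key := mul_le_mul_of_nonneg_left (h.inv_gbarLim_le_log hs) h.pos.le
  rw [mul_add, mul_add, mul_inv_cancel₀ h.pos.ne'] at key
  have hy' : g₀ * (gbarLim β g₀)⁻¹ = y := by rw [hy, div_eq_mul_inv]
  rw [hy'] at key
  -- key : y ≤ 1 + g₀ Σβ + g₀ (4/3 B log y); and g₀·(4/3)B ≤ 1/3
  have hc : g₀ * (4 / 3 * B * Real.log y) ≤ 1 / 3 * (y - 1) := by
    have h1 : g₀ * (4 / 3 * B * Real.log y) = 4 / 3 * (B * g₀) * Real.log y := by ring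
    rw [h1]
    have hlog0 : 0 ≤ Real.log y := Real.log_nonneg hy1
    nlinarith [h.small, mul_nonneg h.B_nonneg h.pos.le]
  nlinarith [key, hc]

/-- **`ǧ_∞⁻¹ + O(|log ǧ_∞|) = g₀⁻¹ + 𝖡_{m²}` with `r = 0`, explicit**: `ḡ_∞⁻¹ ≤ g₀⁻¹ + Σ_jβ_j + (4B/3) log(1 + (3/2)g₀Σ_jβ_j)`; with
`inv_gbarLim_ge`, `|ḡ_∞⁻¹ - (g₀⁻¹ + Σ_jβ_j)| ≤ (4B/3) log(1 + (3/2)g₀Σ_jβ_j)` — "`ǧ_∞⁻¹ + O(|log ǧ_∞|)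
= g₀⁻¹ + 𝖡_{m²}`". [cite: BauerschmidtBrydgesSlade2015LogCorr, §8.3 (ǧ_∞⁻¹ + O(|log ǧ_∞|) = g₀⁻¹ + 𝖡_{m²})] -/
theorem inv_gbarLim_le (hs : Summable β) :
    (gbarLim β g₀)⁻¹ ≤
      g₀⁻¹ + ∑' j, β j + 4 / 3 * B * Real.log (1 + 3 / 2 * (g₀ * ∑' j, β j)) := by
  refine (h.inv_gbarLim_le_log hs).trans (add_le_add le_rfl ?_)
  refine mul_le_mul_of_nonneg_left (Real.log_le_log (div_pos h.pos (h.gbarLim_pos hs)) ?_)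
    (by linarith [h.B_nonneg])
  exact h.div_gbarLim_le hs

/-- The ratio bound in the form used for the asymptotics:
`g₀/ḡ_∞ ≤ 1 + g₀Σ_jβ_j + (4/3)Bg₀ log(1 + (3/2)g₀Σ_jβ_j)`. [cite: BauerschmidtBrydgesSlade2015LogCorr, §8.3 (second lemma, r = 0)] -/
theorem div_gbarLim_le_log (hs : Summable β) :
    g₀ / gbarLim β g₀ ≤
      1 + g₀ * ∑' j, β j + 4 / 3 * B * g₀ * Real.log (1 + 3 / 2 * (g₀ * ∑' j, β j)) := by
  have := mul_le_mul_of_nonneg_left (h.inv_gbarLim_le hs) h.pos.le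
  rw [mul_add, mul_add, mul_inv_cancel₀ h.pos.ne'] at this
  calc g₀ / gbarLim β g₀ = g₀ * (gbarLim β g₀)⁻¹ := div_eq_mul_inv _ _
    _ ≤ _ := this
    _ = _ := by ring

/-- Sandwich for `ḡ_∞Σ_jβ_j`, upper: `ḡ_∞Σ_jβ_j ≤ g₀Σ_jβ_j/(1 + g₀Σ_jβ_j) (< 1)`.
[cite: BauerschmidtBrydgesSlade2015LogCorr, §8.3 (second lemma, r = 0)] -/
theorem gbarLim_mul_tsum_le (hs : Summable β) :
    gbarLim β g₀ * ∑' j, β j ≤ (g₀ * ∑' j, β j) / (1 + g₀ * ∑' j, β j) := by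
  have hL := h.gbarLim_pos hs
  have hS := h.tsum_beta_nonneg
  have hden : 0 < 1 + g₀ * ∑' j, β j := by nlinarith [h.pos]
  have h1 : (1 + g₀ * ∑' j, β j) * gbarLim β g₀ ≤ g₀ := by
    have := h.one_add_le_div_gbarLim hs
    rwa [le_div_iff₀ hL] at this
  rw [le_div_iff₀ hden]
  calc gbarLim β g₀ * (∑' j, β j) * (1 + g₀ * ∑' j, β j)
      = (1 + g₀ * ∑' j, β j) * gbarLim β g₀ * ∑' j, β j := by ring
    _ ≤ g₀ * ∑' j, β j := mul_le_mul_of_nonneg_right h1 hS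

/-- Sandwich for `ḡ_∞Σ_jβ_j`, lower:
`g₀Σ_jβ_j/(1 + g₀Σ_jβ_j + (4/3)Bg₀ log(1 + (3/2)g₀Σ_jβ_j)) ≤ ḡ_∞Σ_jβ_j`.
[cite: BauerschmidtBrydgesSlade2015LogCorr, §8.3 (second lemma, r = 0)] -/
theorem le_gbarLim_mul_tsum (hs : Summable β) :
    (g₀ * ∑' j, β j) /
        (1 + g₀ * ∑' j, β j + 4 / 3 * B * g₀ * Real.log (1 + 3 / 2 * (g₀ * ∑' j, β j))) ≤
      gbarLim β g₀ * ∑' j, β j := by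
  have hL := h.gbarLim_pos hs
  have hS := h.tsum_beta_nonneg
  have hlog : 0 ≤ Real.log (1 + 3 / 2 * (g₀ * ∑' j, β j)) :=
    Real.log_nonneg (by nlinarith [h.pos])
  have hD : 0 < 1 + g₀ * ∑' j, β j + 4 / 3 * B * g₀ * Real.log (1 + 3 / 2 * (g₀ * ∑' j, β j)) := by
    have : 0 ≤ 4 / 3 * B * g₀ * Real.log (1 + 3 / 2 * (g₀ * ∑' j, β j)) :=
      mul_nonneg (by nlinarith [h.B_nonneg, h.pos]) hlog
    nlinarith [h.pos]
  have h1 : g₀ ≤ (1 + g₀ * ∑' j, β j +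
      4 / 3 * B * g₀ * Real.log (1 + 3 / 2 * (g₀ * ∑' j, β j))) * gbarLim β g₀ := by
    have := h.div_gbarLim_le_log hs
    rwa [div_le_iff₀ hL] at this
  rw [div_le_iff₀ hD]
  calc g₀ * ∑' j, β j ≤ (1 + g₀ * ∑' j, β j +
        4 / 3 * B * g₀ * Real.log (1 + 3 / 2 * (g₀ * ∑' j, β j))) * gbarLim β g₀ * ∑' j, β j :=
        mul_le_mul_of_nonneg_right h1 hS
    _ = gbarLim β g₀ * (∑' j, β j) * (1 + g₀ * ∑' j, β j +
        4 / 3 * B * g₀ * Real.log (1 + 3 / 2 * (g₀ * ∑' j, β j))) := by ring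

end GbarHyp

/-! ### `ḡ_∞ ∼ 1/Σ_jβ_j` (the second lemma of §8.3 with `r = 0`: `ǧ_∞ ∼ 1/𝖡_{m²}`) -/

/-- `log(1 + (3/2)u)/u → 0` as `u → ∞`. [folklore] -/
theorem tendsto_log_one_add_div_atTop :
    Tendsto (fun u : ℝ => Real.log (1 + 3 / 2 * u) / u) atTop (𝓝 0) := by
  have h1 : Tendsto (fun u : ℝ => 1 + 3 / 2 * u) atTop atTop :=
    tendsto_atTop_add_const_left _ _ (Tendsto.const_mul_atTop (by norm_num) tendsto_id)
  have h2 := (Real.tendsto_pow_log_div_mul_add_atTop (2 / 3) (-(2 / 3)) 1 (by norm_num)).comp h1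
  refine h2.congr' ?_
  filter_upwards [eventually_gt_atTop 0] with u hu
  simp only [Function.comp_apply, pow_one]
  congr 1
  ring

/-- **`ḡ_∞ · Σ_jβ_j → 1`** along any filter on which `Σ_jβ_j → ∞` and `g₀ → ĝ₀ > 0` (the hypotheses
`GbarHyp (β i) B (g i)` holding throughout): the `r = 0` case of "`ǧ_∞ ∼ 1/𝖡_{m²}` as
`(m², g₀) → (0, ĝ₀)`" (§8.3, second lemma), given `Σ_jβ_j = 𝖡_{m²}` (§8.3, first lemma) and
`𝖡_{m²} → ∞` ((1.8)). [cite: BauerschmidtBrydgesSlade2015LogCorr, §8.3 (second lemma: ǧ_∞ ∼ 1/𝖡_{m²})] -/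
theorem tendsto_gbarLim_mul_tsum {ι : Type*} {l : Filter ι} {βf : ι → ℕ → ℝ} {B : ℝ}
    {g : ι → ℝ} {ĝ₀ : ℝ} (hh : ∀ i, GbarHyp (βf i) B (g i)) (hs : ∀ i, Summable (βf i))
    (hS : Tendsto (fun i => ∑' j, βf i j) l atTop) (hg : Tendsto g l (𝓝 ĝ₀)) (hĝ₀ : 0 < ĝ₀) :
    Tendsto (fun i => gbarLim (βf i) (g i) * ∑' j, βf i j) l (𝓝 1) := by
  set u : ι → ℝ := fun i => g i * ∑' j, βf i j with hu
  have hu_top : Tendsto u l atTop := hg.pos_mul_atTop hĝ₀ hS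
  have huinv : Tendsto (fun i => (u i)⁻¹) l (𝓝 0) := tendsto_inv_atTop_zero.comp hu_top
  have hlg : Tendsto (fun i => Real.log (1 + 3 / 2 * u i) / u i) l (𝓝 0) :=
    tendsto_log_one_add_div_atTop.comp hu_top
  have hc : Tendsto (fun i => 4 / 3 * B * g i) l (𝓝 (4 / 3 * B * ĝ₀)) := hg.const_mul _
  -- the two comparison functions and their limits
  have hup : Tendsto (fun i => ((u i)⁻¹ + 1)⁻¹) l (𝓝 1) := by
    have h1 : Tendsto (fun i => (u i)⁻¹ + 1) l (𝓝 (0 + 1)) := huinv.add tendsto_const_nhds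
    simpa using h1.inv₀ (by norm_num)
  have hlow : Tendsto
      (fun i => ((u i)⁻¹ + 1 + 4 / 3 * B * g i * (Real.log (1 + 3 / 2 * u i) / u i))⁻¹) l (𝓝 1) := by
    have h1 : Tendsto (fun i => (u i)⁻¹ + 1 + 4 / 3 * B * g i * (Real.log (1 + 3 / 2 * u i) / u i))
        l (𝓝 (0 + 1 + 4 / 3 * B * ĝ₀ * 0)) := (huinv.add tendsto_const_nhds).add (hc.mul hlg)
    simpa using h1.inv₀ (by norm_num)
  refine tendsto_of_tendsto_of_tendsto_of_le_of_le' hlow hup ?_ ?_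
  · filter_upwards [hu_top.eventually_gt_atTop 0] with i hui
    have key := (hh i).le_gbarLim_mul_tsum (hs i)
    have hui' : u i = g i * ∑' j, βf i j := rfl
    have hne : u i ≠ 0 := hui.ne'
    calc ((u i)⁻¹ + 1 + 4 / 3 * B * g i * (Real.log (1 + 3 / 2 * u i) / u i))⁻¹
        = u i / (1 + u i + 4 / 3 * B * g i * Real.log (1 + 3 / 2 * u i)) := by
          rw [show (u i)⁻¹ + 1 + 4 / 3 * B * g i * (Real.log (1 + 3 / 2 * u i) / u i)
              = (1 + u i + 4 / 3 * B * g i * Real.log (1 + 3 / 2 * u i)) / u i by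
                field_simp, inv_div]
      _ ≤ gbarLim (βf i) (g i) * ∑' j, βf i j := by rw [hui']; exact key
  · filter_upwards [hu_top.eventually_gt_atTop 0] with i hui
    have key := (hh i).gbarLim_mul_tsum_le (hs i)
    have hne : u i ≠ 0 := hui.ne'
    calc gbarLim (βf i) (g i) * ∑' j, βf i j ≤ u i / (1 + u i) := key
      _ = ((u i)⁻¹ + 1)⁻¹ := by
          field_simp

end CTWSAW

end Literature.Barriers.CriticalPhenomena
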